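import Mathlib
import HarnessLib

/-!
# Parity of conjugate self-dual diagonal parameters of `W_ℂ ⊂ W_ℝ`

Topic `NumberTheory/Automorphic`; namespace `Literature.NumberTheory.Automorphic`.  Theorem file
(definitions with bodies and proved theorems only; provefact unit
`Mok2014_archimedean_parity_of_asaiSign`, 2026-08-16): the LOCAL, archimedean half of the printed
proof of Mok's Corollary 2.5.5 (C. P. Mok, *Endoscopic classification of representations of
quasi-split unitary groups*, Mem. AMS 235 (2015), no. 1108, §2.2 and the Example before Cor. 2.5.5),
formalised verbatim in Mok's matrix language (2.2.5)–(2.2.6).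

Setting.  `E_v / F_v = ℂ / ℝ`, `L_{E_v} = W_ℂ = ℂˣ`, `w_c = j ∈ W_ℝ ∖ W_ℂ` with `j² = -1` and
`w_c⁻¹ z w_c = z̄`.  A (semisimple, diagonalisable) parameter is a homomorphism
`ρ : ℂˣ →* GL_N(ℂ) ⊂ M_N(ℂ)`, `ρ^c(z) = ρ(z̄)`.  Mok (2.2.6): `ρ` is **conjugate self-dual of parity
`η ∈ {±1}`** iff there is `A ∈ GL_N(ℂ)` with `ᵗρ^c(σ) A ρ(σ) = A` for all `σ` and `ᵗA = η · A · ρ(w_c²)`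
(`= η · A · ρ(-1)` here) — `IsConjSelfDualOfParity`.

## What is proved

* `isConjSelfDualOfParity_diagParam` — a diagonal parameter `diag(χ_i)` of characters with
  `χ_i(z̄) χ_i(z) = 1` and `χ_i(-1) = ε` for all `i` is conjugate self-dual of parity `ε` (take `A = I`;
  Mok's Example before Cor. 2.5.5);
* `apply_neg_one_eq_of_isConjSelfDualOfParity_diagParam` — conversely, if the `χ_i` are pairwise
  distinct (the multiplicity-free = elliptic case) and `diag(χ_i)` has parity `η`, then `χ_i(-1) = η`
  for every `i`; in particular the parity is unique (Mok, Remark 2.2.2; the form `A` is forced to be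
  diagonal by the invariance, and the sign condition is read on the diagonal);
* the unitary characters `(z/|z|)^m = (z/z̄)^{m/2}` (`unitArgChar`, Mok's convention
  `(z/z̄)^{1/2} := z / |z z̄|^{1/2}` of (2.5.12)): conjugate-inverse, value `(-1)^m` at `-1`, pairwise
  distinct; hence for `ρ = diag((z/|z|)^{m_i})` with distinct `m_i` (the shape (2.5.12), `a_i = m_i/2`):
  parity `η` holds iff `(-1)^{m_i} = η` for all `i`
  (`isConjSelfDualOfParity_unitaryDiagParam`, `neg_one_zpow_eq_of_isConjSelfDualOfParity_unitaryDiagParam`,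
  `parity_unique_unitaryDiagParam`);
* the coset arithmetic of the tree's rendering of Cor. 2.5.5 (`Mok2014_archimedean_parity_of_asaiSign`,
  `AsaiSign.lean`): `(-1)^m = (-1)^{N-1} κ ↔ m/2 ∈ (N-1)/2 + (1-κ)/4 + ℤ`
  (`neg_one_zpow_eq_iff_exists_half_eq`), and the packaged local step
  `exists_half_eq_of_isConjSelfDualOfParity_unitaryDiagParam`: **if `diag((z/|z|)^{m_i})` (distinct
  `m_i`) is conjugate self-dual of parity `(-1)^{N-1} κ`, then every `a_i = m_i / 2` lies in
  `(N-1)/2 + (1-κ)/4 + ℤ`** — exactly the conclusion of the named fact, whose remaining (global) input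
  is Mok's Thm. 2.4.10 with Lemma 2.2.1 (the parameter of `Π_v` is conjugate self-dual of parity
  `(-1)^{N-1} κ(Π)`) and the local Langlands correspondence for `GL_N(ℂ)` tying the archimedean
  parameter `HasArchParameter` to `ρ`; neither is in the tree, and nothing here depends on them.

## References

* C. P. Mok, *Endoscopic classification of representations of quasi-split unitary groups*,
  Mem. Amer. Math. Soc. 235 (2015), no. 1108 (arXiv:1206.0882): §2.2, (2.2.3)–(2.2.6), Lemma 2.2.1,
  Remark 2.2.2 (pp. 8–9 of the arXiv version); Example and (2.5.12) before Cor. 2.5.5 (p. 21). [Mok2014]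
* W. T. Gan, B. H. Gross, D. Prasad, *Symplectic local root numbers, central critical `L`-values, and
  restriction problems in the representation theory of classical groups*, Astérisque 346 (2012), §3
  (conjugate-dual representations and their signs). [GanGrossPrasad2012]
-/

noncomputable section

open scoped ComplexConjugate Matrix
open Complex

namespace Literature.NumberTheory.Automorphic

/-! ## Conjugation on `W_ℂ = ℂˣ` and the parity condition (2.2.6) -/

section Parity

variable {ι : Type*} [Fintype ι] [DecidableEq ι]

/-- Complex conjugation on `W_ℂ = ℂˣ` as a monoid homomorphism: the action `z ↦ w_c⁻¹ z w_c = z̄` of an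
element `w_c ∈ W_ℝ ∖ W_ℂ` on `W_ℂ`, so that `ρ^c = ρ ∘ weilConj` (Mok, (2.2.3)). [cite: Mok2014, (2.2.3)] -/
def weilConj : ℂˣ →* ℂˣ :=
  Units.map (starRingEnd ℂ : ℂ →+* ℂ).toMonoidHom

/-- `weilConj z = z̄` on underlying complex numbers. [cite: Mok2014, (2.2.3)] -/
@[simp]
theorem coe_weilConj (z : ℂˣ) : ((weilConj z : ℂˣ) : ℂ) = conj (z : ℂ) :=
  rfl

/-- `weilConj (-1) = -1` (`w_c` centralises `w_c² = -1`). [folklore] -/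
@[simp]
theorem weilConj_neg_one : weilConj (-1) = -1 := by
  ext; simp

/-- **Conjugate self-duality with parity, matrix form** (Mok, (2.2.5)–(2.2.6), for `L_{E_v} = W_ℂ = ℂˣ`,
`w_c = j`, `w_c² = -1`, `ρ^c(z) = ρ(z̄)`): the parameter `ρ : ℂˣ →* M_N(ℂ)` is conjugate self-dual of
parity `η ∈ {±1}` if there is an invertible matrix `A` (a non-degenerate bilinear form
`B(x, y) = ᵗx A y`) with `ᵗρ^c(z) A ρ(z) = A` for all `z` (i.e. `B(ρ^c(z) x, ρ(z) y) = B(x, y)`,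
(2.2.4)) and `ᵗA = η · A · ρ(w_c²) = η · A · ρ(-1)` (i.e. `B(x, y) = η B(y, ρ(w_c²) x)`, (2.2.5)).
Parity `+1`: conjugate orthogonal; `-1`: conjugate symplectic (Gan–Gross–Prasad, §3).
[cite: Mok2014, (2.2.5)–(2.2.6)] -/
def IsConjSelfDualOfParity (ρ : ℂˣ →* Matrix ι ι ℂ) (η : ℤˣ) : Prop :=
  ∃ A : Matrix ι ι ℂ, IsUnit A.det ∧ (∀ z : ℂˣ, (ρ (weilConj z))ᵀ * A * ρ z = A) ∧
    Aᵀ = ((η : ℤ) : ℂ) • (A * ρ (-1))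

/-- **Diagonal parameters**: `z ↦ diag(χ_1(z), …, χ_N(z))` for characters `χ_i : ℂˣ →* ℂ` — a direct
sum of one-dimensional representations of `W_ℂ` (the shape (2.5.12) of Mok's Example before
Cor. 2.5.5). [cite: Mok2014, (2.5.12)] -/
def diagParam (χ : ι → (ℂˣ →* ℂ)) : ℂˣ →* Matrix ι ι ℂ where
  toFun z := Matrix.diagonal fun i => χ i z
  map_one' := by simp
  map_mul' z w := by
    rw [Matrix.diagonal_mul_diagonal]
    simp [map_mul]

/-- Unfolding `diagParam`. [cite: Mok2014, (2.5.12)] -/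
@[simp]
theorem diagParam_apply (χ : ι → (ℂˣ →* ℂ)) (z : ℂˣ) :
    diagParam χ z = Matrix.diagonal fun i => χ i z :=
  rfl

/-- `ε · ε = 1` in `ℂ` for a sign `ε ∈ ℤˣ = {±1}`. [folklore] -/
theorem intUnits_cast_complex_mul_self (ε : ℤˣ) : ((ε : ℤ) : ℂ) * ((ε : ℤ) : ℂ) = 1 := by
  rcases Int.units_eq_one_or ε with rfl | rfl <;> simp

/-- **Mok's Example before Cor. 2.5.5, general form (parity of a diagonal parameter with `A = I`).**
If every character `χ_i` is conjugate-inverse (`χ_i(z̄) χ_i(z) = 1`, i.e. conjugate self-dual as a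
one-dimensional parameter) and `χ_i(-1) = ε` for all `i`, then `diag(χ_i)` is conjugate self-dual of
parity `ε`: in (2.2.6) take `A = I_N`; then `ᵗρ^c(z) ρ(z) = diag(χ_i(z̄) χ_i(z)) = I` and
`ᵗI = I = ε · I · ρ(-1)` as `ρ(-1) = ε I`. [cite: Mok2014, Example before Cor. 2.5.5 and (2.2.6)] -/
theorem isConjSelfDualOfParity_diagParam {χ : ι → (ℂˣ →* ℂ)} {ε : ℤˣ}
    (hconj : ∀ i z, χ i (weilConj z) * χ i z = 1) (hε : ∀ i, χ i (-1) = ((ε : ℤ) : ℂ)) :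
    IsConjSelfDualOfParity (diagParam χ) ε := by
  refine ⟨1, by simp, fun z => ?_, ?_⟩
  · simp only [diagParam_apply, Matrix.diagonal_transpose, Matrix.mul_one,
      Matrix.diagonal_mul_diagonal, hconj, Matrix.diagonal_one]
  · simp only [Matrix.transpose_one, diagParam_apply, hε, Matrix.one_mul]
    rw [show (Matrix.diagonal fun _ : ι => ((ε : ℤ) : ℂ)) = ((ε : ℤ) : ℂ) • (1 : Matrix ι ι ℂ) by
      ext i j; by_cases h : i = j <;> simp [h]]
    rw [smul_smul, intUnits_cast_complex_mul_self, one_smul]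

/-- **Mok, Remark 2.2.2 for diagonal parameters (uniqueness of the parity in the multiplicity-free
case).**  If the characters `χ_i` are conjugate-inverse and pairwise distinct and `diag(χ_i)` is
conjugate self-dual of parity `η` with form `A`, then `χ_i(-1) = η` for every `i`.  Proof: the
`(i, j)` entry of `ᵗρ^c(z) A ρ(z) = A` reads `χ_i(z̄) A_{ij} χ_j(z) = A_{ij}`, i.e.
`A_{ij} (χ_j(z) - χ_i(z)) = 0`, so `A` is diagonal (the `χ_i` being distinct) with non-zero diagonal
entries (`det A ≠ 0`); the `(i, i)` entry of `ᵗA = η A ρ(-1)` reads `A_{ii} = η A_{ii} χ_i(-1)`.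
(Mok: "if `ρ = ρ_1 ⊕ ⋯ ⊕ ρ_r` with the `ρ_i` mutually non-isomorphic, irreducible conjugate self-dual
… the parity of `ρ` is also unique".) [cite: Mok2014, Remark 2.2.2 and (2.2.6)] -/
theorem apply_neg_one_eq_of_isConjSelfDualOfParity_diagParam {χ : ι → (ℂˣ →* ℂ)} {η : ℤˣ}
    (hconj : ∀ i z, χ i (weilConj z) * χ i z = 1) (hne : ∀ i j, i ≠ j → ∃ z, χ i z ≠ χ j z)
    (h : IsConjSelfDualOfParity (diagParam χ) η) (i : ι) : χ i (-1) = ((η : ℤ) : ℂ) := by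
  obtain ⟨A, hA, hinv, hsign⟩ := h
  -- off-diagonal entries of `A` vanish
  have hoff : ∀ i j, i ≠ j → A i j = 0 := by
    intro i j hij
    obtain ⟨z, hz⟩ := hne i j hij
    have hz' : χ j z - χ i z ≠ 0 := sub_ne_zero.mpr (Ne.symm hz)
    have h1 := congrFun (congrFun (hinv z) i) j
    simp only [diagParam_apply, Matrix.diagonal_transpose, Matrix.mul_diagonal,
      Matrix.diagonal_mul] at h1
    have h2 : A i j * (χ j z - χ i z) = 0 := by
      linear_combination (χ i z) * h1 - (A i j * χ j z) * hconj i z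
    exact (mul_eq_zero.mp h2).resolve_right hz'
  -- hence `A` is diagonal with non-zero diagonal entries
  have hAd : A = Matrix.diagonal fun i => A i i := by
    ext i j
    by_cases hij : i = j
    · subst hij; simp
    · rw [Matrix.diagonal_apply_ne _ hij, hoff i j hij]
  have hii : A i i ≠ 0 := by
    rw [hAd, Matrix.det_diagonal] at hA
    exact Finset.prod_ne_zero_iff.mp hA.ne_zero i (Finset.mem_univ i)
  -- read the sign condition on the diagonal
  have h3 := congrFun (congrFun hsign i) i
  simp only [Matrix.transpose_apply, diagParam_apply, Matrix.smul_apply, Matrix.mul_diagonal,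
    smul_eq_mul] at h3
  -- `h3 : A i i = η * (A i i * χ i (-1))`
  have h4 : A i i * (((η : ℤ) : ℂ) * χ i (-1) - 1) = 0 := by linear_combination -h3
  have h5 : ((η : ℤ) : ℂ) * χ i (-1) = 1 := sub_eq_zero.mp ((mul_eq_zero.mp h4).resolve_left hii)
  linear_combination ((η : ℤ) : ℂ) * h5 - χ i (-1) * intUnits_cast_complex_mul_self η

/-- **Uniqueness of the parity** of a multiplicity-free diagonal parameter (Mok, Remark 2.2.2): with
the `χ_i` conjugate-inverse and pairwise distinct and `N ≥ 1`, two parities of `diag(χ_i)` coincide.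
[cite: Mok2014, Remark 2.2.2] -/
theorem isConjSelfDualOfParity_diagParam_unique [Nonempty ι] {χ : ι → (ℂˣ →* ℂ)} {η η' : ℤˣ}
    (hconj : ∀ i z, χ i (weilConj z) * χ i z = 1) (hne : ∀ i j, i ≠ j → ∃ z, χ i z ≠ χ j z)
    (h : IsConjSelfDualOfParity (diagParam χ) η) (h' : IsConjSelfDualOfParity (diagParam χ) η') :
    η = η' := by
  obtain ⟨i⟩ := ‹Nonempty ι›
  have h1 := apply_neg_one_eq_of_isConjSelfDualOfParity_diagParam hconj hne h i
  have h2 := apply_neg_one_eq_of_isConjSelfDualOfParity_diagParam hconj hne h' i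
  have h3 : ((η : ℤ) : ℂ) = ((η' : ℤ) : ℂ) := h1.symm.trans h2
  exact Units.ext (by exact_mod_cast h3)

end Parity

/-! ## The unitary characters `(z/|z|)^m = (z/z̄)^{m/2}` and the shape (2.5.12) -/

section UnitaryCharacters

/-- The unitary character `z ↦ (z/|z|)^m` of `W_ℂ = ℂˣ`, `m ∈ ℤ`; in Mok's notation `(z/z̄)^{m/2}`
with "the usual interpretation of `(z/z̄)^{1/2}`, i.e. `(z/z̄)^{1/2} := z / |z z̄|^{1/2}`" (so that the
exponent `a = m/2 ∈ ½ℤ` of (2.5.12) corresponds to `m = 2a`). [cite: Mok2014, (2.5.12)] -/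
def unitArgChar (m : ℤ) : ℂˣ →* ℂ where
  toFun z := ((z : ℂ) / ‖(z : ℂ)‖) ^ m
  map_one' := by simp
  map_mul' z w := by
    simp only [Units.val_mul, norm_mul, Complex.ofReal_mul]
    rw [mul_div_mul_comm, mul_zpow]

/-- Unfolding `unitArgChar`. [cite: Mok2014, (2.5.12)] -/
theorem unitArgChar_apply (m : ℤ) (z : ℂˣ) : unitArgChar m z = ((z : ℂ) / ‖(z : ℂ)‖) ^ m :=
  rfl

/-- `z/|z|` lies on the unit circle for `z ≠ 0`. [folklore] -/
theorem norm_div_norm_units (z : ℂˣ) : ‖(z : ℂ) / ‖(z : ℂ)‖‖ = 1 := by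
  rw [norm_div, Complex.norm_real, Real.norm_eq_abs, abs_norm]
  exact div_self (norm_ne_zero_iff.mpr z.ne_zero)

/-- `conj (z/|z|) = (z/|z|)⁻¹`. [folklore] -/
theorem conj_div_norm_units (z : ℂˣ) :
    conj ((z : ℂ) / ‖(z : ℂ)‖) = (((z : ℂ) / ‖(z : ℂ)‖))⁻¹ := by
  refine eq_inv_of_mul_eq_one_left ?_
  rw [mul_comm, Complex.mul_conj, Complex.normSq_eq_norm_sq, norm_div_norm_units]
  simp

/-- **`(z/|z|)^m` is conjugate-inverse**: `χ(z̄) = χ(z)⁻¹`, i.e. each `unitArgChar m` is a conjugate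
self-dual one-dimensional parameter. [cite: Mok2014, (2.5.12)] -/
theorem unitArgChar_weilConj (m : ℤ) (z : ℂˣ) :
    unitArgChar m (weilConj z) = (unitArgChar m z)⁻¹ := by
  simp only [unitArgChar_apply, coe_weilConj, Complex.norm_conj]
  rw [← inv_zpow, ← conj_div_norm_units, map_div₀, Complex.conj_ofReal]

/-- `χ(z̄) χ(z) = 1` for `χ = (z/|z|)^m`. [cite: Mok2014, (2.5.12)] -/
theorem unitArgChar_weilConj_mul (m : ℤ) (z : ℂˣ) :
    unitArgChar m (weilConj z) * unitArgChar m z = 1 := by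
  rw [unitArgChar_weilConj]
  refine inv_mul_cancel₀ ?_
  rw [unitArgChar_apply]
  exact zpow_ne_zero _ (norm_ne_zero_iff.mp (by rw [norm_div_norm_units]; exact one_ne_zero))

/-- **Mok, (2.5.12) ⇒ `φ(j²) = φ(-1) = (-1)^{2a_i} I_N`**: the value of `(z/|z|)^m` at `-1` is `(-1)^m`.
[cite: Mok2014, Example before Cor. 2.5.5] -/
theorem unitArgChar_neg_one (m : ℤ) : unitArgChar m (-1) = (-1) ^ m := by
  simp [unitArgChar_apply]

/-- **Distinct exponents give distinct characters**: for `m ≠ m'` there is `z` (namely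
`z = exp(π i / (m - m'))`) with `(z/|z|)^m ≠ (z/|z|)^{m'}`. [folklore] -/
theorem exists_unitArgChar_apply_ne {m m' : ℤ} (h : m ≠ m') :
    ∃ z : ℂˣ, unitArgChar m z ≠ unitArgChar m' z := by
  set d : ℤ := m - m' with hd
  have hd0 : (d : ℂ) ≠ 0 := by exact_mod_cast sub_ne_zero.mpr h
  set u : ℂ := Complex.exp (((Real.pi / d : ℝ) : ℂ) * I) with hu
  have hu1 : ‖u‖ = 1 := by rw [hu, Complex.norm_exp_ofReal_mul_I]
  have hu0 : u ≠ 0 := Complex.exp_ne_zero _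
  refine ⟨Units.mk0 u hu0, fun heq => ?_⟩
  simp only [unitArgChar_apply, Units.val_mk0, hu1, Complex.ofReal_one, div_one] at heq
  -- `u ^ m = u ^ m'` forces `u ^ d = 1`, but `u ^ d = exp(π i) = -1`
  have hd1 : u ^ d = 1 := by
    rw [hd, zpow_sub₀ hu0, heq, div_self (zpow_ne_zero _ hu0)]
  have hd2 : u ^ d = -1 := by
    rw [hu, ← Complex.exp_int_mul, ← Complex.exp_pi_mul_I]
    congr 1
    push_cast
    field_simp
  rw [hd1] at hd2
  norm_num at hd2

variable {ι : Type*} [Fintype ι] [DecidableEq ι]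

/-- **Mok's parameter shape (2.5.12)**: `z ↦ diag((z/z̄)^{a_1}, …, (z/z̄)^{a_N})` with `a_i = m_i / 2`,
as a diagonal parameter of `W_ℂ`. [cite: Mok2014, (2.5.12)] -/
abbrev unitaryDiagParam (m : ι → ℤ) : ℂˣ →* Matrix ι ι ℂ :=
  diagParam fun i => unitArgChar (m i)

/-- **Mok's Example before Cor. 2.5.5** (the computation `φ(j²) = φ(-1) = (-1)^{2a_i} I_N`, "from
equation (2.2.6) we see that this implies `φ` is conjugate self-dual of parity `(-1)^{2a_i}` (taking the
matrix `A` there to be the identity matrix)"): if `(-1)^{m_i} = ε` for all `i`, then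
`diag((z/|z|)^{m_i})` is conjugate self-dual of parity `ε`. [cite: Mok2014, Example before Cor. 2.5.5] -/
theorem isConjSelfDualOfParity_unitaryDiagParam {m : ι → ℤ} {ε : ℤˣ}
    (hε : ∀ i, (-1 : ℂ) ^ (m i) = ((ε : ℤ) : ℂ)) :
    IsConjSelfDualOfParity (unitaryDiagParam m) ε :=
  isConjSelfDualOfParity_diagParam (fun i z => unitArgChar_weilConj_mul (m i) z)
    fun i => by rw [unitArgChar_neg_one, hε]

/-- **Mok, Remark 2.2.2 with (2.2.6) for the shape (2.5.12)**: if the `m_i` are distinct (the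
parameter is multiplicity free, "elliptic") and `diag((z/|z|)^{m_i})` is conjugate self-dual of parity
`η`, then `(-1)^{m_i} = η` for every `i` — the parity is pinned by, and pins, the common parity of the
exponents `2a_i = m_i`. [cite: Mok2014, Remark 2.2.2 and Example before Cor. 2.5.5] -/
theorem neg_one_zpow_eq_of_isConjSelfDualOfParity_unitaryDiagParam {m : ι → ℤ}
    (hm : Function.Injective m) {η : ℤˣ} (h : IsConjSelfDualOfParity (unitaryDiagParam m) η)
    (i : ι) : (-1 : ℂ) ^ (m i) = ((η : ℤ) : ℂ) := by
  rw [← unitArgChar_neg_one]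
  exact apply_neg_one_eq_of_isConjSelfDualOfParity_diagParam
    (fun i z => unitArgChar_weilConj_mul (m i) z)
    (fun _ _ hij => exists_unitArgChar_apply_ne fun hm' => hij (hm hm')) h i

/-- **The parity of the shape (2.5.12) is unique** (Mok, Remark 2.2.2: `φ^N_v ∈ Φ̃_{ell,v}(N)`, "thus
the parity of `φ^N_v` is unique"), for `N ≥ 1` and distinct exponents. [cite: Mok2014, Remark 2.2.2] -/
theorem parity_unique_unitaryDiagParam [Nonempty ι] {m : ι → ℤ} (hm : Function.Injective m)
    {η η' : ℤˣ} (h : IsConjSelfDualOfParity (unitaryDiagParam m) η)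
    (h' : IsConjSelfDualOfParity (unitaryDiagParam m) η') : η = η' :=
  isConjSelfDualOfParity_diagParam_unique (fun i z => unitArgChar_weilConj_mul (m i) z)
    (fun _ _ hij => exists_unitArgChar_apply_ne fun hm' => hij (hm hm')) h h'

/-- **Mok's Example before Cor. 2.5.5, as printed (the contradiction)**: a multiplicity-free parameter
of shape (2.5.12) whose exponents satisfy `(-1)^{2a_i} = ε` cannot be conjugate self-dual of parity
`-ε` ("… a contradiction. Thus we conclude that `κ = 1`"). [cite: Mok2014, Example before Cor. 2.5.5] -/
theorem not_isConjSelfDualOfParity_neg_unitaryDiagParam [Nonempty ι] {m : ι → ℤ}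
    (hm : Function.Injective m) {ε : ℤˣ} (hε : ∀ i, (-1 : ℂ) ^ (m i) = ((ε : ℤ) : ℂ)) :
    ¬ IsConjSelfDualOfParity (unitaryDiagParam m) (-ε) := by
  intro h
  have := parity_unique_unitaryDiagParam hm (isConjSelfDualOfParity_unitaryDiagParam hε) h
  rcases Int.units_eq_one_or ε with rfl | rfl <;> simp at this

end UnitaryCharacters

/-! ## The coset arithmetic of the tree's rendering of Cor. 2.5.5 -/

section Coset

/-- The sign `(-1)^{N-1} κ` of Lemma 2.2.1 (spelled `(-1)^{N+1} κ` in `ℤˣ`, as in `HasAsaiSign`) cast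
to `ℂ`. [folklore] -/
theorem intUnits_cast_neg_one_pow_mul (N : ℕ) (κ : ℤˣ) :
    ((((-1 : ℤˣ) ^ (N + 1) * κ : ℤˣ) : ℤ) : ℂ) = (-1 : ℂ) ^ (N + 1) * ((κ : ℤ) : ℂ) := by
  rcases Nat.even_or_odd (N + 1) with h | h
  · have h1 : ((-1 : ℤˣ) ^ (N + 1)) = 1 := h.neg_one_pow
    rw [h1, h.neg_one_pow, one_mul, one_mul]
  · have h1 : ((-1 : ℤˣ) ^ (N + 1)) = -1 := h.neg_one_pow
    rw [h1, h.neg_one_pow, Units.val_mul, Units.val_neg, Units.val_one]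
    push_cast
    ring

/-- `(-1)^a = (-1)^b` in `ℂ` iff `a - b` is even. [folklore] -/
theorem neg_one_zpow_eq_neg_one_zpow_iff_even_sub (a b : ℤ) :
    (-1 : ℂ) ^ a = (-1 : ℂ) ^ b ↔ Even (a - b) := by
  have h1 : (-1 : ℂ) ≠ 0 := by norm_num
  rw [← div_eq_one_iff_eq (zpow_ne_zero b h1), ← zpow_sub₀ h1]
  refine ⟨fun h => ?_, fun h => h.neg_one_zpow⟩
  rcases Int.even_or_odd (a - b) with he | ho
  · exact he
  · rw [ho.neg_one_zpow] at h; norm_num at h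

/-- **Coset arithmetic**: for `m ∈ ℤ`, `N ∈ ℕ`, `κ ∈ {±1}`:
`(-1)^m = (-1)^{N-1} κ` (spelled `(-1)^{N+1} κ`) iff `m/2 ∈ (N-1)/2 + (1-κ)/4 + ℤ` — the translation
between the parity `(-1)^{2a_i}` of the exponent `a_i = m/2` and the coset form of the conclusion of
`Mok2014_archimedean_parity_of_asaiSign` (`κ = 1`: `a_i ∈ (N-1)/2 + ℤ`; `κ = -1`: `a_i ∈ N/2 + ℤ`).
[folklore] -/
theorem neg_one_zpow_eq_iff_exists_half_eq (m : ℤ) (N : ℕ) (κ : ℤˣ) :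
    (-1 : ℂ) ^ m = (-1) ^ (N + 1) * ((κ : ℤ) : ℂ) ↔
      ∃ k : ℤ, (m : ℂ) / 2 = (k : ℂ) + ((N : ℂ) - 1) / 2 + (1 - ((κ : ℤ) : ℂ)) / 4 := by
  -- write `κ = (-1)^e`, `e ∈ {0, 1}`, so that `(1 - κ)/4 = e/2`
  obtain ⟨e, he01, hκ, hκ'⟩ : ∃ e : ℤ, (e = 0 ∨ e = 1) ∧ ((κ : ℤ) : ℂ) = (-1) ^ e ∧
      (1 - ((κ : ℤ) : ℂ)) / 4 = (e : ℂ) / 2 := by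
    rcases Int.units_eq_one_or κ with rfl | rfl
    · exact ⟨0, Or.inl rfl, by simp, by simp⟩
    · exact ⟨1, Or.inr rfl, by simp, by push_cast; ring⟩
  rw [hκ', hκ, show ((-1 : ℂ) ^ (N + 1) : ℂ) = (-1 : ℂ) ^ ((N : ℤ) + 1) by norm_cast,
    ← zpow_add₀ (by norm_num : (-1 : ℂ) ≠ 0), neg_one_zpow_eq_neg_one_zpow_iff_even_sub]
  constructor
  · rintro ⟨r, hr⟩
    refine ⟨r + 1, ?_⟩
    have hm : (m : ℂ) = ((r + r + (N + 1 + e) : ℤ) : ℂ) := by exact_mod_cast (sub_eq_iff_eq_add.mp hr)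
    rw [hm]; push_cast; ring
  · rintro ⟨k, hk⟩
    refine ⟨k - 1, ?_⟩
    have hk' : ((m : ℤ) : ℂ) = (((2 * k + N - 1 + e : ℤ)) : ℂ) := by
      push_cast; linear_combination 2 * hk
    have hm : m = 2 * k + N - 1 + e := by exact_mod_cast hk'
    rw [hm]; ring

/-- **The local half of Mok's Cor. 2.5.5 in the tree's coset form.**  If the multiplicity-free parameter
`z ↦ diag((z/|z|)^{m_1}, …, (z/|z|)^{m_N})` of `W_ℂ` (shape (2.5.12), `a_i = m_i/2`, distinct) is
conjugate self-dual of parity `(-1)^{N-1} κ` — which is what Mok's Thm. 2.4.10 with Lemma 2.2.1 assert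
for the parameter of `Π_v` at a place `v` of `F` with `E_v/F_v = ℂ/ℝ`, `Π` conjugate self-dual cuspidal
of sign `κ` — then every exponent `a_i = m_i / 2` lies in the coset `(N-1)/2 + (1-κ)/4 + ℤ` (Remark 2.2.2
and (2.2.6): `(-1)^{m_i} = (-1)^{N-1} κ`).  This is exactly the conclusion of the named fact
`Mok2014_archimedean_parity_of_asaiSign` (`AsaiSign.lean`); the global input (Thm. 2.4.10) and the local
Langlands correspondence for `GL_N(ℂ)` are not in the tree and are not used here.
[cite: Mok2014, Example before Cor. 2.5.5, Remark 2.2.2 and Cor. 2.5.5] -/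
theorem exists_half_eq_of_isConjSelfDualOfParity_unitaryDiagParam {N : ℕ} {m : Fin N → ℤ}
    (hm : Function.Injective m) {κ : ℤˣ}
    (h : IsConjSelfDualOfParity (unitaryDiagParam m) ((-1) ^ (N + 1) * κ)) (i : Fin N) :
    ∃ k : ℤ, (m i : ℂ) / 2 = (k : ℂ) + ((N : ℂ) - 1) / 2 + (1 - ((κ : ℤ) : ℂ)) / 4 := by
  rw [← neg_one_zpow_eq_iff_exists_half_eq, ← intUnits_cast_neg_one_pow_mul]
  exact neg_one_zpow_eq_of_isConjSelfDualOfParity_unitaryDiagParam hm h i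

/-- **Converse (Mok's Example with `A = I`, coset form)**: if every exponent `a_i = m_i/2` lies in
`(N-1)/2 + (1-κ)/4 + ℤ`, then `diag((z/|z|)^{m_i})` is conjugate self-dual of parity `(-1)^{N-1} κ`
(no distinctness needed). [cite: Mok2014, Example before Cor. 2.5.5] -/
theorem isConjSelfDualOfParity_unitaryDiagParam_of_exists_half_eq {N : ℕ} {m : Fin N → ℤ} {κ : ℤˣ}
    (h : ∀ i, ∃ k : ℤ, (m i : ℂ) / 2 = (k : ℂ) + ((N : ℂ) - 1) / 2 + (1 - ((κ : ℤ) : ℂ)) / 4) :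
    IsConjSelfDualOfParity (unitaryDiagParam m) ((-1) ^ (N + 1) * κ) := by
  refine isConjSelfDualOfParity_unitaryDiagParam fun i => ?_
  rw [intUnits_cast_neg_one_pow_mul]
  exact (neg_one_zpow_eq_iff_exists_half_eq (m i) N κ).mpr (h i)

end Coset

end Literature.NumberTheory.Automorphic
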